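import Mathlib
import HarnessLib
import Literature.Computability.AlgebraicComplexity.AsymptoticRankMultiplesMatMul
import Summits.MatrixMultiplication.MatrixMultiplication.Theses.OutsiderSandwich
import Summits.MatrixMultiplication.MatrixMultiplication.Theorems.OutsiderSandwichTopFibreTensor
import Summits.MatrixMultiplication.MatrixMultiplication.Theorems.OutsiderSandwichFaceCertificates
import Summits.MatrixMultiplication.MatrixMultiplication.Theorems.OutsiderSandwichContactFace
import Summits.MatrixMultiplication.MatrixMultiplication.Theorems.OutsiderSandwichBlock

/-!
# OutsiderSandwich — THE BUNDLED PRICE of a matrix product: both cruxes of the cut as the two ends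
of one ω-free asymptotic invariant (decomp-mm lens 4 «minimal counterexample», gen 35, part 3/4)

Route `route-MatrixMultiplication-OutsiderSandwich`; cut of record UNCHANGED:
`closes (h₁ : LaserTangency) (h₂ : LaserMergeOptimal) (h₃ : SummitIffLaserTangency) : ω(ℂ) = 2`,
`LaserMergeOptimal` (stmt-27897) the declared residual; theorem-only, definition-free support.

THE OBJECT.  In the tensor semiring `T(ℂ)` (tree: `TensorClass`, `≲ = AsympLe (· ≤ ·)` =
sub-exponentially helped restriction of Kronecker powers, g19 `asympLe_mk_iff_helped`) write
`a = [⟨2,2,2⟩]`, `c = [cw₂]`.  The laser floor is the valid inequality `27a ≲ 4c³` (g34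
`laserFloor_asympLe`); its FACE (parts 1–2) is the set of laser-TIGHT universal spectral points
(`27 F⟨2,2,2⟩ = 4 F(cw₂)³`, i.e. `x_F = log₂3 + (τ_F − 2)/3`; `tight_iff_touching`).  A **certificate**
`(p, q, n) ∈ ℕ³` is the asymptotic restriction

    `(q + 27n)·[⟨2,2,2⟩]  ≲  ⟨p⟩ ⊕ 4n·[cw₂]^{⊠3}`                                    (cert p q n)

— `q` matrix products BEYOND the `27n` the laser method extracts from `4n` cubes of `cw₂`, paid for by a
diagonal `⟨p⟩`; `p/q` is the PRICE of an extra product when BUNDLED with laser extractions.  Unbundled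
(`n = 0`) the price is `R̃(⟨2,2,2⟩) = 2^ω` (`cert_unbundled_iff`).

§1 Dictionary and certificates (`tight_iff_touching`, `cert_sound`, `four_mul_le_of_cert`,
   `cert_unbundled_iff`, `cert_add`).
§2 **THE BUNDLED PRICE IS `2^{τ*}`** (`τ* = sSup touchingExponents`, g13/g15; `rpow_sSup_le_of_cert`,
   `isGLB_bundledPrice`, `rpow_sSup_touching_eq_sInf`):

     `2^{τ*} = max {F⟨2,2,2⟩ : F laser-tight} = inf { p/q : q ≥ 1, ∃ n, cert p q n } ∈ [4, 2^ω]`.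

§3–§4 (sibling file `OutsiderSandwichSubsidy`): THE CUT IS A SANDWICH ON THIS ONE NUMBER —
   `LaserTangency ⟺ ∀ p q, 4q < p → ∃ n, cert p q n` (price `4`), `LaserMergeOptimal ⟺ ∀ p q n,
   cert p q n → q·a ≲ p` («laser bundling never subsidises matrix multiplication», price `2^ω`), the
   normal form `(p, q, n)` of a counterexample to the residual and its necessary conditions.

Honest tags: support only (NEC for nothing new); every statement is asymptotic (no finite level is
decided; level-`N` shadows of a certificate are dominated by the laser method's `o(N)` losses);
`ω` enters §3 only through `q·a ≲ p ⟺ q·2^ω ≤ p`.  Nearest prior art: Alman–Li–Pratt arXiv:2604.01386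
§3 (localised preorders), Wigderson–Zuiddam 2023 Thm. 3.26; the identification of the route's `τ*`
with an inf over integer restriction certificates inside `T(ℂ)` is new in the tree.
References: [cite: Strassen1988, Thm. 2.3–2.4, Thm. 3.8]; [cite: Zuiddam2018, Thm. 2.12, Cor. 2.13,
Thm. 2.15]; [cite: CoppersmithWinograd1990, §6]; [cite: ChristandlVranaZuiddam2023, §1.2, Thm. 4.20].
-/

set_option linter.dupNamespace false

noncomputable section

namespace Summit.MatrixMultiplication.MatrixMultiplication.Theorems.OutsiderSandwichBundledPrice

open Literature.Computability.AlgebraicComplexity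
open Summit.MatrixMultiplication.MatrixMultiplication.Theses.OutsiderSandwich
open Summit.MatrixMultiplication.MatrixMultiplication.Theorems.OutsiderSandwichLaserFloor
  (laserFloor two_le_matExp)
open Summit.MatrixMultiplication.MatrixMultiplication.Theorems.OutsiderSandwichLaserFloorCut
  (three_le_map_cwTensor matExp_le_omega)
open Summit.MatrixMultiplication.MatrixMultiplication.Theorems.OutsiderSandwichBlock
  (map_matMulTensor_pos map_matMulTensor_le_four_of_matExp_le_two matExp_le_two_of_map_le_four)
open Summit.MatrixMultiplication.MatrixMultiplication.Theorems.OutsiderSandwichTouchingExponent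
  (touchingExponents touchingExponents_subset_Icc bddAbove_touchingExponents
    laserTangency_iff_subset_two)
open Summit.MatrixMultiplication.MatrixMultiplication.Theorems.OutsiderSandwichContactFace
  (gaugePoint₁_cwTensor_two gaugePoint₁_matMulTensor_two sSup_touchingExponents_mem)
open Summit.MatrixMultiplication.MatrixMultiplication.Theorems.OutsiderSandwichTopFibreTensor
  (asympRankOf_mk_matMul laserFloor_cube laserFloor_asympLe xExp_le_floor_iff
    laserMergeOptimal_iff_top_le map_matMul_eq_iff_matExp_eq)
open Summit.MatrixMultiplication.MatrixMultiplication.Theorems.OutsiderSandwichFaceLocalisation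
open Summit.MatrixMultiplication.MatrixMultiplication.Theorems.OutsiderSandwichFaceCertificates

variable {F : SpectralMap ℂ}

/-! ## §1  Dictionary: tight points = the face of the laser floor; certificates -/

/-- The laser floor `27a ≲ 4c³` is valid at every spectral point of `T(ℂ)`. [cite: CoppersmithWinograd1990, §6] -/
theorem laserFloor_valid (φ : TensorClass ℂ → ℝ)
    (hφ : IsSpectralPoint (fun x y : TensorClass ℂ => x ≤ y) φ) :
    φ (((27 : ℕ) : TensorClass ℂ) * TensorClass.mk (matMulTensor ℂ 2 2 2)) ≤
      φ (((4 : ℕ) : TensorClass ℂ) * TensorClass.mk (cwTensor ℂ 2) ^ 3) :=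
  ((TensorClass.isStrassenPreorder ℂ).asympLe_iff_forall_spectralPoint.1 laserFloor_asympLe) φ hφ

/-- The face condition of the laser floor at a spectral point, unfolded. -/
theorem face_iff {φ : TensorClass ℂ → ℝ} (hφ : IsSpectralPoint (fun x y : TensorClass ℂ => x ≤ y) φ) :
    φ (((27 : ℕ) : TensorClass ℂ) * TensorClass.mk (matMulTensor ℂ 2 2 2)) =
      φ (((4 : ℕ) : TensorClass ℂ) * TensorClass.mk (cwTensor ℂ 2) ^ 3) ↔
    27 * φ (TensorClass.mk (matMulTensor ℂ 2 2 2)) = 4 * φ (TensorClass.mk (cwTensor ℂ 2)) ^ 3 := by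
  rw [hφ.map_mul, hφ.map_mul, hφ.map_natCast, hφ.map_natCast, hφ.map_pow]
  push_cast
  exact Iff.rfl

/-- **Bridge (∀).**  A property of the pair of values `(F⟨2,2,2⟩, F(cw₂))` holds at every TIGHT
universal point iff it holds on the face of the laser floor in `X(T(ℂ))`.
[cite: ChristandlVranaZuiddam2023, §1.2] -/
theorem forall_tight_iff_abstract (R : ℝ → ℝ → Prop) :
    (∀ F : SpectralMap ℂ, IsUniversalSpectralPoint ℂ F →
        27 * F (matMulTensor ℂ 2 2 2) = 4 * F (cwTensor ℂ 2) ^ 3 →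
        R (F (matMulTensor ℂ 2 2 2)) (F (cwTensor ℂ 2))) ↔
    (∀ φ : TensorClass ℂ → ℝ, IsSpectralPoint (fun x y : TensorClass ℂ => x ≤ y) φ →
        φ (((27 : ℕ) : TensorClass ℂ) * TensorClass.mk (matMulTensor ℂ 2 2 2)) =
          φ (((4 : ℕ) : TensorClass ℂ) * TensorClass.mk (cwTensor ℂ 2) ^ 3) →
        R (φ (TensorClass.mk (matMulTensor ℂ 2 2 2))) (φ (TensorClass.mk (cwTensor ℂ 2)))) := by
  constructor
  · intro H φ hφ hface
    have hU := TensorClass.isUniversalSpectralPoint_spectralMapOf hφ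
    have h1 := H _ hU (by
      rw [TensorClass.spectralMapOf_apply, TensorClass.spectralMapOf_apply]
      exact (face_iff hφ).1 hface)
    rwa [TensorClass.spectralMapOf_apply, TensorClass.spectralMapOf_apply] at h1
  · intro H F hF htight
    have h1 := H _ (TensorClass.isSpectralPoint_eval hF) (by
      rw [face_iff (TensorClass.isSpectralPoint_eval hF), TensorClass.eval_mk hF, TensorClass.eval_mk hF]
      exact htight)
    rwa [TensorClass.eval_mk hF, TensorClass.eval_mk hF] at h1

/-- **Bridge (∃).** [cite: ChristandlVranaZuiddam2023, §1.2] -/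
theorem exists_tight_iff_abstract (R : ℝ → ℝ → Prop) :
    (∃ F : SpectralMap ℂ, IsUniversalSpectralPoint ℂ F ∧
        27 * F (matMulTensor ℂ 2 2 2) = 4 * F (cwTensor ℂ 2) ^ 3 ∧
        R (F (matMulTensor ℂ 2 2 2)) (F (cwTensor ℂ 2))) ↔
    (∃ φ : TensorClass ℂ → ℝ, IsSpectralPoint (fun x y : TensorClass ℂ => x ≤ y) φ ∧
        φ (((27 : ℕ) : TensorClass ℂ) * TensorClass.mk (matMulTensor ℂ 2 2 2)) =
          φ (((4 : ℕ) : TensorClass ℂ) * TensorClass.mk (cwTensor ℂ 2) ^ 3) ∧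
        R (φ (TensorClass.mk (matMulTensor ℂ 2 2 2))) (φ (TensorClass.mk (cwTensor ℂ 2)))) := by
  constructor
  · rintro ⟨F, hF, htight, hR⟩
    refine ⟨TensorClass.eval F, TensorClass.isSpectralPoint_eval hF, ?_, ?_⟩
    · rw [face_iff (TensorClass.isSpectralPoint_eval hF), TensorClass.eval_mk hF, TensorClass.eval_mk hF]
      exact htight
    · rwa [TensorClass.eval_mk hF, TensorClass.eval_mk hF]
  · rintro ⟨φ, hφ, hface, hR⟩
    refine ⟨TensorClass.spectralMapOf φ, TensorClass.isUniversalSpectralPoint_spectralMapOf hφ, ?_, ?_⟩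
    · rw [TensorClass.spectralMapOf_apply, TensorClass.spectralMapOf_apply]
      exact (face_iff hφ).1 hface
    · rwa [TensorClass.spectralMapOf_apply, TensorClass.spectralMapOf_apply]

/-- **Tight (cubed) ⟺ touching (g13's log form)**: `27 F⟨2,2,2⟩ = 4 F(cw₂)³ ⟺ x_F = log₂3 + (τ_F−2)/3`.
[cite: CoppersmithWinograd1990, §6] -/
theorem tight_iff_touching (hF : IsUniversalSpectralPoint ℂ F) :
    27 * F (matMulTensor ℂ 2 2 2) = 4 * F (cwTensor ℂ 2) ^ 3 ↔
      Real.logb 2 (F (cwTensor ℂ 2)) =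
        Real.logb 2 3 + (Real.logb 2 (F (matMulTensor ℂ 2 2 2)) - 2) / 3 := by
  have hfloor := laserFloor hF
  have hcube := laserFloor_cube hF
  have key := xExp_le_floor_iff hF
  constructor
  · intro h
    exact le_antisymm (key.2 h.symm.le) hfloor
  · intro h
    exact le_antisymm hcube (key.1 h.le)

/-- The first gauge point `ζ₁` is tight, with `ζ₁⟨2,2,2⟩ = 4`, `ζ₁(cw₂) = 3` (`108 = 108`).
[cite: Strassen1988, Thm. 3.8; ChristandlVranaZuiddam2023, Thm. 4.20] -/
theorem gaugePoint₁_tight :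
    27 * gaugePoint₁ ℂ (matMulTensor ℂ 2 2 2) = 4 * gaugePoint₁ ℂ (cwTensor ℂ 2) ^ 3 := by
  rw [gaugePoint₁_matMulTensor_two, gaugePoint₁_cwTensor_two]; norm_num

/-- The face of the laser floor is nonempty (it contains `ζ₁`). [cite: Strassen1988, Thm. 3.8] -/
theorem face_nonempty :
    ∃ φ : TensorClass ℂ → ℝ, IsSpectralPoint (fun x y : TensorClass ℂ => x ≤ y) φ ∧
      φ (((27 : ℕ) : TensorClass ℂ) * TensorClass.mk (matMulTensor ℂ 2 2 2)) =
        φ (((4 : ℕ) : TensorClass ℂ) * TensorClass.mk (cwTensor ℂ 2) ^ 3) := by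
  obtain ⟨φ, hφ, hface, -⟩ := (exists_tight_iff_abstract (fun _ _ => True)).1
    ⟨gaugePoint₁ ℂ, gaugePoint₁_isUniversalSpectralPoint ℂ, gaugePoint₁_tight, trivial⟩
  exact ⟨φ, hφ, hface⟩

/-- `1 ≤ [⟨2,2,2⟩]` in `T(ℂ)` (the tensor is nonzero). [cite: ChristandlVranaZuiddam2023, §1.2] -/
theorem one_le_mk_matMul : (1 : TensorClass ℂ) ≤ TensorClass.mk (matMulTensor ℂ 2 2 2) := by
  refine TensorClass.one_le_mk fun h0 => ?_
  have h := matMulTensor_apply_zero_ne_zero ℂ (k := 2) (m := 2) (n := 2) two_pos two_pos two_pos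
  exact h (by rw [h0]; rfl)

/-- **Soundness**: a certificate `(q + 27n)a ≲ p + 4n c³` gives `q·F⟨2,2,2⟩ ≤ p` at every tight
universal point. [cite: Zuiddam2018, Thm. 2.12] -/
theorem cert_sound {p q n : ℕ}
    (hc : AsympLe (fun x y : TensorClass ℂ => x ≤ y)
      ((q : TensorClass ℂ) * TensorClass.mk (matMulTensor ℂ 2 2 2) +
        (n : TensorClass ℂ) * (((27 : ℕ) : TensorClass ℂ) * TensorClass.mk (matMulTensor ℂ 2 2 2)))
      ((p : TensorClass ℂ) + (n : TensorClass ℂ) * (((4 : ℕ) : TensorClass ℂ) * TensorClass.mk (cwTensor ℂ 2) ^ 3))) :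
    ∀ F : SpectralMap ℂ, IsUniversalSpectralPoint ℂ F →
      27 * F (matMulTensor ℂ 2 2 2) = 4 * F (cwTensor ℂ 2) ^ 3 → (q : ℝ) * F (matMulTensor ℂ 2 2 2) ≤ p :=
  (forall_tight_iff_abstract (fun s _ => (q : ℝ) * s ≤ p)).2
    (face_le_of_cert (TensorClass.isStrassenPreorder ℂ) hc)

/-- **Every certificate pays at least `4` a product**: `4q ≤ p` (evaluate at `ζ₁`).
[cite: Strassen1988, Thm. 3.8] -/
theorem four_mul_le_of_cert {p q n : ℕ}
    (hc : AsympLe (fun x y : TensorClass ℂ => x ≤ y)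
      ((q : TensorClass ℂ) * TensorClass.mk (matMulTensor ℂ 2 2 2) +
        (n : TensorClass ℂ) * (((27 : ℕ) : TensorClass ℂ) * TensorClass.mk (matMulTensor ℂ 2 2 2)))
      ((p : TensorClass ℂ) + (n : TensorClass ℂ) * (((4 : ℕ) : TensorClass ℂ) * TensorClass.mk (cwTensor ℂ 2) ^ 3))) :
    4 * q ≤ p := by
  have h := cert_sound hc _ (gaugePoint₁_isUniversalSpectralPoint ℂ) gaugePoint₁_tight
  rw [gaugePoint₁_matMulTensor_two] at h
  have h' : ((4 * q : ℕ) : ℝ) ≤ p := by push_cast; linarith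
  exact_mod_cast h'

/-- **Unbundled price = `2^ω`**: `q·a ≲ p ⟺ q·2^ω ≤ p`. [cite: Strassen1988, Thm. 3.8; Zuiddam2018, Cor. 2.13] -/
theorem cert_unbundled_iff (p q : ℕ) :
    AsympLe (fun x y : TensorClass ℂ => x ≤ y)
      ((q : TensorClass ℂ) * TensorClass.mk (matMulTensor ℂ 2 2 2)) (p : TensorClass ℂ) ↔
    (q : ℝ) * (2 : ℝ) ^ omega ℂ ≤ p := by
  rw [asympLe_natMul_natCast_iff (TensorClass.isStrassenPreorder ℂ) one_le_mk_matMul, asympRankOf_mk_matMul]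

/-- **Certificates add** (the normal forms form a semigroup). [cite: Zuiddam2018, Thm. 2.12] -/
theorem cert_add {p q n p' q' n' : ℕ}
    (hc : AsympLe (fun x y : TensorClass ℂ => x ≤ y)
      ((q : TensorClass ℂ) * TensorClass.mk (matMulTensor ℂ 2 2 2) +
        (n : TensorClass ℂ) * (((27 : ℕ) : TensorClass ℂ) * TensorClass.mk (matMulTensor ℂ 2 2 2)))
      ((p : TensorClass ℂ) + (n : TensorClass ℂ) * (((4 : ℕ) : TensorClass ℂ) * TensorClass.mk (cwTensor ℂ 2) ^ 3)))
    (hc' : AsympLe (fun x y : TensorClass ℂ => x ≤ y)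
      ((q' : TensorClass ℂ) * TensorClass.mk (matMulTensor ℂ 2 2 2) +
        (n' : TensorClass ℂ) * (((27 : ℕ) : TensorClass ℂ) * TensorClass.mk (matMulTensor ℂ 2 2 2)))
      ((p' : TensorClass ℂ) + (n' : TensorClass ℂ) * (((4 : ℕ) : TensorClass ℂ) * TensorClass.mk (cwTensor ℂ 2) ^ 3))) :
    AsympLe (fun x y : TensorClass ℂ => x ≤ y)
      (((q + q' : ℕ) : TensorClass ℂ) * TensorClass.mk (matMulTensor ℂ 2 2 2) +
        ((n + n' : ℕ) : TensorClass ℂ) * (((27 : ℕ) : TensorClass ℂ) * TensorClass.mk (matMulTensor ℂ 2 2 2)))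
      (((p + p' : ℕ) : TensorClass ℂ) +
        ((n + n' : ℕ) : TensorClass ℂ) * (((4 : ℕ) : TensorClass ℂ) * TensorClass.mk (cwTensor ℂ 2) ^ 3)) := by
  have hS := TensorClass.isStrassenPreorder ℂ
  refine hS.asympLe_of_forall_spectralPoint _ _ fun φ hφ => ?_
  have h1 := (hS.asympLe_iff_forall_spectralPoint.1 hc) φ hφ
  have h2 := (hS.asympLe_iff_forall_spectralPoint.1 hc') φ hφ
  simp only [hφ.map_add, hφ.map_mul, hφ.map_natCast, hφ.map_pow] at h1 h2 ⊢
  push_cast at h1 h2 ⊢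
  linarith

/-! ## §2  The bundled price is `2^{τ*}`, `τ* = sSup touchingExponents` -/

/-- A tight universal point has `F⟨2,2,2⟩ ≤ 2^{τ*}`. [cite: Strassen1988, Thm. 2.3] -/
theorem map_matMul_le_rpow_sSup_of_tight (hF : IsUniversalSpectralPoint ℂ F)
    (ht : 27 * F (matMulTensor ℂ 2 2 2) = 4 * F (cwTensor ℂ 2) ^ 3) :
    F (matMulTensor ℂ 2 2 2) ≤ (2 : ℝ) ^ sSup touchingExponents := by
  have hmem : Real.logb 2 (F (matMulTensor ℂ 2 2 2)) ∈ touchingExponents :=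
    ⟨F, hF, rfl, (tight_iff_touching hF).1 ht⟩
  have h1 : Real.logb 2 (F (matMulTensor ℂ 2 2 2)) ≤ sSup touchingExponents :=
    le_csSup bddAbove_touchingExponents hmem
  have h0 := map_matMulTensor_pos hF
  calc F (matMulTensor ℂ 2 2 2) = (2 : ℝ) ^ Real.logb 2 (F (matMulTensor ℂ 2 2 2)) :=
        (Real.rpow_logb two_pos (by norm_num) h0).symm
    _ ≤ (2 : ℝ) ^ sSup touchingExponents := Real.rpow_le_rpow_of_exponent_le one_le_two h1

/-- **The maximal tight point `F†`**: a tight universal point with `F†⟨2,2,2⟩ = 2^{τ*}`, maximal among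
tight points (g15 `sSup_touchingExponents_mem`). [cite: Strassen1988, Thm. 2.3] -/
theorem exists_tight_max :
    ∃ F : SpectralMap ℂ, IsUniversalSpectralPoint ℂ F ∧
      27 * F (matMulTensor ℂ 2 2 2) = 4 * F (cwTensor ℂ 2) ^ 3 ∧
      F (matMulTensor ℂ 2 2 2) = (2 : ℝ) ^ sSup touchingExponents ∧
      ∀ G : SpectralMap ℂ, IsUniversalSpectralPoint ℂ G →
        27 * G (matMulTensor ℂ 2 2 2) = 4 * G (cwTensor ℂ 2) ^ 3 →
        G (matMulTensor ℂ 2 2 2) ≤ F (matMulTensor ℂ 2 2 2) := by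
  obtain ⟨F, hF, hτ, hx⟩ := sSup_touchingExponents_mem
  have ht : 27 * F (matMulTensor ℂ 2 2 2) = 4 * F (cwTensor ℂ 2) ^ 3 := by
    rw [tight_iff_touching hF, hx, hτ]
  have hval : F (matMulTensor ℂ 2 2 2) = (2 : ℝ) ^ sSup touchingExponents := by
    rw [← hτ, Real.rpow_logb two_pos (by norm_num) (map_matMulTensor_pos hF)]
  refine ⟨F, hF, ht, hval, fun G hG hGt => ?_⟩
  rw [hval]
  exact map_matMul_le_rpow_sSup_of_tight hG hGt

/-- **A certificate bounds the price from above by its ratio**: `2^{τ*} ≤ p/q`.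
[cite: Zuiddam2018, Thm. 2.12; Strassen1988, Thm. 2.3] -/
theorem rpow_sSup_le_of_cert {p q n : ℕ} (hq : 0 < q)
    (hc : AsympLe (fun x y : TensorClass ℂ => x ≤ y)
      ((q : TensorClass ℂ) * TensorClass.mk (matMulTensor ℂ 2 2 2) +
        (n : TensorClass ℂ) * (((27 : ℕ) : TensorClass ℂ) * TensorClass.mk (matMulTensor ℂ 2 2 2)))
      ((p : TensorClass ℂ) + (n : TensorClass ℂ) * (((4 : ℕ) : TensorClass ℂ) * TensorClass.mk (cwTensor ℂ 2) ^ 3))) :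
    (2 : ℝ) ^ sSup touchingExponents ≤ p / q := by
  obtain ⟨F, hF, ht, hval, -⟩ := exists_tight_max
  have h1 := cert_sound hc F hF ht
  rw [hval] at h1
  rw [le_div_iff₀ (by exact_mod_cast hq : (0 : ℝ) < q)]
  linarith [mul_comm (q : ℝ) ((2 : ℝ) ^ sSup touchingExponents)]

/-- **THE BUNDLED PRICE (localised Strassen duality at the laser face):**
`2^{τ*}` is the greatest lower bound of the certificate ratios `{p/q : q ≥ 1, ∃ n, cert p q n}`.
[cite: Zuiddam2018, Thm. 2.12, Cor. 2.13, Thm. 2.15; Strassen1988, Thm. 2.3, Thm. 3.8] -/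
theorem isGLB_bundledPrice :
    IsGLB {t : ℝ | ∃ p q n : ℕ, 0 < q ∧ t = (p : ℝ) / q ∧
      AsympLe (fun x y : TensorClass ℂ => x ≤ y)
        ((q : TensorClass ℂ) * TensorClass.mk (matMulTensor ℂ 2 2 2) +
          (n : TensorClass ℂ) * (((27 : ℕ) : TensorClass ℂ) * TensorClass.mk (matMulTensor ℂ 2 2 2)))
        ((p : TensorClass ℂ) + (n : TensorClass ℂ) * (((4 : ℕ) : TensorClass ℂ) * TensorClass.mk (cwTensor ℂ 2) ^ 3))}
      ((2 : ℝ) ^ sSup touchingExponents) := by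
  obtain ⟨F, hF, ht, hval, hmax⟩ := exists_tight_max
  obtain ⟨φ₀, hφ₀, hφ₀f, hR⟩ := (exists_tight_iff_abstract (fun s _ => s = (2 : ℝ) ^ sSup touchingExponents ∧
      ∀ G : SpectralMap ℂ, IsUniversalSpectralPoint ℂ G →
        27 * G (matMulTensor ℂ 2 2 2) = 4 * G (cwTensor ℂ 2) ^ 3 → G (matMulTensor ℂ 2 2 2) ≤ s)).1
    ⟨F, hF, ht, hval, hmax⟩
  obtain ⟨hφ₀val, hφ₀max⟩ := hR
  have hmax' := (forall_tight_iff_abstract (fun s _ => s ≤ φ₀ (TensorClass.mk (matMulTensor ℂ 2 2 2)))).1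
    hφ₀max
  rw [← hφ₀val]
  exact isGLB_faceMax (TensorClass.isStrassenPreorder ℂ) laserFloor_valid hφ₀ hφ₀f
    (fun ψ hψ hψf => hmax' ψ hψ hψf)

/-- **`2^{τ*} = inf {p/q : q ≥ 1, ∃ n, (q + 27n)·[⟨2,2,2⟩] ≲ ⟨p⟩ ⊕ 4n·[cw₂]³}`.**
[cite: Zuiddam2018, Thm. 2.12, Cor. 2.13, Thm. 2.15; Strassen1988, Thm. 3.8] -/
theorem rpow_sSup_touching_eq_sInf :
    (2 : ℝ) ^ sSup touchingExponents = sInf {t : ℝ | ∃ p q n : ℕ, 0 < q ∧ t = (p : ℝ) / q ∧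
      AsympLe (fun x y : TensorClass ℂ => x ≤ y)
        ((q : TensorClass ℂ) * TensorClass.mk (matMulTensor ℂ 2 2 2) +
          (n : TensorClass ℂ) * (((27 : ℕ) : TensorClass ℂ) * TensorClass.mk (matMulTensor ℂ 2 2 2)))
        ((p : TensorClass ℂ) + (n : TensorClass ℂ) * (((4 : ℕ) : TensorClass ℂ) * TensorClass.mk (cwTensor ℂ 2) ^ 3))} := by
  exact (isGLB_bundledPrice.csInf_eq
    ⟨_, rankOf (fun x y : TensorClass ℂ => x ≤ y) (TensorClass.mk (matMulTensor ℂ 2 2 2)), 1, 0,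
      one_pos, rfl, cert_rankOf (TensorClass.isStrassenPreorder ℂ) _ _ _⟩).symm

/-- The price lies in `[4, 2^ω]`. [cite: Strassen1988, Thm. 2.3–2.4, Thm. 3.8] -/
theorem bundledPrice_mem_Icc :
    (2 : ℝ) ^ sSup touchingExponents ∈ Set.Icc (4 : ℝ) ((2 : ℝ) ^ omega ℂ) := by
  obtain ⟨F, hF, ht, hval, -⟩ := exists_tight_max
  have hτ : Real.logb 2 (F (matMulTensor ℂ 2 2 2)) ∈ touchingExponents :=
    ⟨F, hF, rfl, (tight_iff_touching hF).1 ht⟩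
  have h2 := (touchingExponents_subset_Icc hτ)
  rw [← hval]
  constructor
  · have := (Real.le_logb_iff_rpow_le one_lt_two (map_matMulTensor_pos hF)).1 h2.1
    rw [Real.rpow_two] at this
    linarith
  · have := (Real.logb_le_iff_le_rpow one_lt_two (map_matMulTensor_pos hF)).1 h2.2
    exact this

end Summit.MatrixMultiplication.MatrixMultiplication.Theorems.OutsiderSandwichBundledPrice

end
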